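import Summits.CriticalPhenomena.PercolationContinuityZ3.Theorems.Transplant.KNCells2ChainPlanar
import HarnessLib

/-!
# Corridor chain, the PLANAR SCHEDULE with a CONSTANT number of steps (87): in units `t = r/4` — 10 rounds shrinking the cube `M_x` along the
# axis, 11 across it (inside `Q_x`), the start step onto the first face, and 65 advance steps (Kozma–Nitzan's Lemma 11) along `H_{x,y}` — each
# with core, region, target (= the next core) and ROUTE LEMMA (square prisms, for p3-g2's `deep_h3`)
# (design HOME/prim-bschramm-p2-g2/F8-DESIGN.md §9; supersedes the `K`-dependent schedule of `KNCells2ChainSchedule`, whose length `23K - 2`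
# would make the chain accuracy depend on `K` — the number of target-lemma applications must not depend on `K`, exactly as in KN's Lemma 12)

builds on p205010 (kernel theorem, internal audit signed; external expert review pending) — nothing in this file uses p205010.
Lane `prim-bschramm`, seat `prim-bschramm-p2` (Corridor-over-levels); helper file (`--supports stmt-CriticalPhenomena-4575`).  Pure `Site 2` geometry.

Parameters: the unit `t` (`r = 4t`), the neighbourhood radius `R'` (levels + kit cube) and the minimal route scale `ℓ₀`, with `100 R' ≤ t`,
`R' + ℓ₀ ≤ t`.  Step `i ≤ 86`: core `core i = sBox a σ c (coreα i) (coreβ i) (coreW i)`; `i ≤ 10`: `{|level| ≤ 12t - it, |trans| ≤ 12t + iR'}`;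
`10 ≤ i ≤ 21`: `{|level| ≤ 2t + (i-10)R', |trans| ≤ 12t + 10R' - (i-10)t}`; `i = 21 + j ≥ 22`: the face `{level = 2t + 11R' + jt,
|trans| ≤ w₁ + (j-1)R'}`, `w₁ = 6t + 34R'`.  Region: the `Q`-box `{|level|,|trans| ≤ 20t}` for `i ≤ 21`, the slab `{L - 2t ≤ level ≤ L + t,
|trans| ≤ 8t}` after.  `core 0 = {|·| ≤ 12t} = M_x` (`3r = 12t`); `core 87 ⊆ {68t ≤ level ≤ 88t, |trans| ≤ 8t} ⊆ M_y ∩ H_{x,y}`.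
* `core_route` — from every `v` in the `R'`-enlargement of `core i` (`i ≤ 86`) a square `v + Λ_ℓ ⊆ region i`, `ℓ ≥ ℓ₀`, with a quarter-face in
  `core (i+1)`; `enlarge_core_subset_region`, `core_succ_subset_region`, `region_subset_boxes`, `core_nonempty`, `core_zero`, `core_last_subset`.
[cite: KozmaNitzan2024, §4 Lemma 11 (pp. 22–23), Lemma 12 (pp. 23–25)]
-/

noncomputable section

namespace Summit.CriticalPhenomena.PercolationContinuityZ3.Theorems

namespace Transplant

namespace ChainPlanar

namespace Sched

open Literature.Probability.Percolation Literature.Probability.LatticeModels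
open Literature.Probability.Percolation.KozmaNitzan
open Literature.Probability.Percolation.KozmaNitzan.Cells (oth oth_ne eq_oth_of_ne)

variable (t R' : ℕ)

/-- The index of the last step. [folklore] -/
def nLast : ℕ := 86

/-- The width `w₁ = 6t + 34R'` of the first face. [folklore] -/
def w₁ : ℤ := 6 * (t : ℤ) + 34 * R'

/-- Lower level of the core of step `i`. [folklore] -/
def coreα (i : ℕ) : ℤ :=
  if i ≤ 10 then -(12 * (t : ℤ) - (i : ℤ) * t)
  else if i ≤ 21 then -(2 * (t : ℤ) + ((i - 10 : ℕ) : ℤ) * R')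
  else 2 * (t : ℤ) + 11 * R' + ((i - 21 : ℕ) : ℤ) * t

/-- Upper level of the core of step `i`. [folklore] -/
def coreβ (i : ℕ) : ℤ :=
  if i ≤ 10 then 12 * (t : ℤ) - (i : ℤ) * t
  else if i ≤ 21 then 2 * (t : ℤ) + ((i - 10 : ℕ) : ℤ) * R'
  else 2 * (t : ℤ) + 11 * R' + ((i - 21 : ℕ) : ℤ) * t

/-- Transverse half-width of the core of step `i`. [folklore] -/
def coreW (i : ℕ) : ℤ :=
  if i ≤ 10 then 12 * (t : ℤ) + (i : ℤ) * R'
  else if i ≤ 21 then 12 * (t : ℤ) + 10 * R' - ((i - 10 : ℕ) : ℤ) * t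
  else w₁ t R' + ((i - 22 : ℕ) : ℤ) * R'

/-- **The core of step `i`** (centre `c`, axis `a`, sign `σ`). [cite: KozmaNitzan2024, §4 Lemmas 11–12] -/
def core (a : Fin 2) (σ : ℤ) (c : Site 2) (i : ℕ) : Finset (Site 2) :=
  sBox a σ c (coreα t R' i) (coreβ t R' i) (coreW t R' i)

/-- **The region of step `i`**: the `Q`-box during the shrinking and the start, the Lemma-11 slab during the advance.
[cite: KozmaNitzan2024, §4 Lemmas 11–12] -/
def region (a : Fin 2) (σ : ℤ) (c : Site 2) (i : ℕ) : Finset (Site 2) :=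
  if i ≤ 21 then sBox a σ c (-(20 * (t : ℤ))) (20 * t) (20 * t)
  else sBox a σ c (coreα t R' i - 2 * t) (coreα t R' i + t) (8 * t)

/-! ## The parameters of each phase -/

variable {t R'}

/-- Core of a shrink-along round `i ≤ 10`. [folklore] -/
theorem core_AL {i : ℕ} (hi : i ≤ 10) :
    coreα t R' i = -(12 * (t : ℤ) - (i : ℤ) * t) ∧ coreβ t R' i = 12 * (t : ℤ) - (i : ℤ) * t ∧ coreW t R' i = 12 * (t : ℤ) + (i : ℤ) * R' := by
  refine ⟨?_, ?_, ?_⟩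
  · unfold coreα; rw [if_pos hi]
  · unfold coreβ; rw [if_pos hi]
  · unfold coreW; rw [if_pos hi]

/-- Core of a shrink-across round `i = 10 + m`, `m ≤ 11`. [folklore] -/
theorem core_AT {i m : ℕ} (him : i = 10 + m) (hm : m ≤ 11) :
    coreα t R' i = -(2 * (t : ℤ) + (m : ℤ) * R') ∧ coreβ t R' i = 2 * (t : ℤ) + (m : ℤ) * R' ∧
      coreW t R' i = 12 * (t : ℤ) + 10 * R' - (m : ℤ) * t := by
  by_cases h0 : i ≤ 10
  · have hm0 : m = 0 := by omega
    have hi : i = 10 := by omega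
    subst hm0
    refine ⟨?_, ?_, ?_⟩
    · unfold coreα; rw [if_pos h0, hi]; push_cast; ring
    · unfold coreβ; rw [if_pos h0, hi]; push_cast; ring
    · unfold coreW; rw [if_pos h0, hi]; push_cast; ring
  · have h2 : i ≤ 21 := by omega
    have e : i - 10 = m := by omega
    refine ⟨?_, ?_, ?_⟩
    · unfold coreα; rw [if_neg h0, if_pos h2, e]
    · unfold coreβ; rw [if_neg h0, if_pos h2, e]
    · unfold coreW; rw [if_neg h0, if_pos h2, e]

/-- Core of the face `j ≥ 1` of the advance, `i = 21 + j`. [folklore] -/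
theorem core_B {i j : ℕ} (hij : i = 21 + j) (hj : 1 ≤ j) :
    coreα t R' i = 2 * (t : ℤ) + 11 * R' + (j : ℤ) * t ∧ coreβ t R' i = 2 * (t : ℤ) + 11 * R' + (j : ℤ) * t ∧
      coreW t R' i = w₁ t R' + ((j : ℤ) - 1) * R' := by
  have h0 : ¬(i ≤ 10) := by omega
  have h2 : ¬(i ≤ 21) := by omega
  have e : i - 21 = j := by omega
  have e' : ((i - 22 : ℕ) : ℤ) = (j : ℤ) - 1 := by
    rw [show i - 22 = j - 1 by omega]; push_cast [hj]; ring
  refine ⟨?_, ?_, ?_⟩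
  · unfold coreα; rw [if_neg h0, if_neg h2, e]
  · unfold coreβ; rw [if_neg h0, if_neg h2, e]
  · unfold coreW; rw [if_neg h0, if_neg h2, e']

/-- The region during the shrinking and the start. [folklore] -/
theorem region_A {a : Fin 2} {σ : ℤ} {c : Site 2} {i : ℕ} (hi : i ≤ 21) :
    region t R' a σ c i = sBox a σ c (-(20 * (t : ℤ))) (20 * t) (20 * t) := by
  unfold region; rw [if_pos hi]

/-- The region during the advance. [folklore] -/
theorem region_B {a : Fin 2} {σ : ℤ} {c : Site 2} {i j : ℕ} (hij : i = 21 + j) (hj : 1 ≤ j) :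
    region t R' a σ c i = sBox a σ c (2 * (t : ℤ) + 11 * R' + (j : ℤ) * t - 2 * t) (2 * (t : ℤ) + 11 * R' + (j : ℤ) * t + t) (8 * t) := by
  have h2 : ¬(i ≤ 21) := by omega
  unfold region; rw [if_neg h2, (core_B (t := t) (R' := R') hij hj).1]

/-! ## The route lemma of every step -/

section Route

variable {a : Fin 2} {σ : ℤ} (hσ : σ = 1 ∨ σ = -1) (c : Site 2) {ℓ₀ : ℕ} (hR : 100 * R' ≤ t) (hℓ : R' + ℓ₀ ≤ t)
include hσ hR hℓ

/-- Routes of the shrink-along rounds `i < 10`. [cite: KozmaNitzan2024, §4 Lemma 12 (pp. 23–25)] -/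
theorem core_route_AL {i : ℕ} (hi : i < 10) {v : Site 2}
    (hv : v ∈ sBox a σ c (coreα t R' i - R') (coreβ t R' i + R') (coreW t R' i + R')) :
    ∃ ℓ : ℕ, ℓ₀ ≤ ℓ ∧ shiftF v (box 2 ℓ) ⊆ region t R' a σ c i ∧
      ∃ (a' : Fin 2) (τ : Fin 2 → ℤˣ), shiftF v (orthantFace a' τ ℓ) ⊆ core t R' a σ c (i + 1) := by
  have hR' : 100 * (R' : ℤ) ≤ t := by exact_mod_cast hR
  have hℓ' : (R' : ℤ) + ℓ₀ ≤ t := by exact_mod_cast hℓ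
  obtain ⟨eα, eβ, eW⟩ := core_AL (t := t) (R' := R') hi.le
  obtain ⟨eα', eβ', eW'⟩ := core_AL (t := t) (R' := R') (i := i + 1) hi
  have his : ((i : ℤ) + 1) * t ≤ 10 * t := mul_le_mul_of_nonneg_right (by exact_mod_cast (show i + 1 ≤ 10 from hi)) (by positivity)
  have hiR : (i : ℤ) * R' ≤ 10 * R' := mul_le_mul_of_nonneg_right (by exact_mod_cast hi.le) (by positivity)
  have hi0 : (0 : ℤ) ≤ (i : ℤ) * t := by positivity
  have hiR0 : (0 : ℤ) ≤ (i : ℤ) * R' := by positivity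
  have ht0 : (0 : ℤ) ≤ t := by positivity
  rw [eα, eβ, eW] at hv
  obtain ⟨ℓ, hℓ0, -, hsq, τ, hface⟩ := route_shrinkLong hσ c (u := 12 * (t : ℤ) - (i : ℤ) * t)
    (u' := 12 * (t : ℤ) - ((i : ℤ) + 1) * t) (w := 12 * (t : ℤ) + (i : ℤ) * R') (Δ := t) (ρ := 20 * t) (R' := R') (ℓ₀ := ℓ₀)
    (by ring) (by linarith) ht0 (by linarith) (by linarith) (by linarith) hv
  refine ⟨ℓ, hℓ0, by rw [region_A (by omega)]; exact hsq, a, τ, ?_⟩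
  rw [core, eα', eβ', eW']
  convert hface using 2 <;> push_cast <;> ring

/-- Routes of the shrink-across rounds `10 ≤ i < 21`. [cite: KozmaNitzan2024, §4 Lemma 12 (pp. 23–25)] -/
theorem core_route_AT {i : ℕ} (h1 : 10 ≤ i) (h2 : i < 21) {v : Site 2}
    (hv : v ∈ sBox a σ c (coreα t R' i - R') (coreβ t R' i + R') (coreW t R' i + R')) :
    ∃ ℓ : ℕ, ℓ₀ ≤ ℓ ∧ shiftF v (box 2 ℓ) ⊆ region t R' a σ c i ∧
      ∃ (a' : Fin 2) (τ : Fin 2 → ℤˣ), shiftF v (orthantFace a' τ ℓ) ⊆ core t R' a σ c (i + 1) := by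
  have hR' : 100 * (R' : ℤ) ≤ t := by exact_mod_cast hR
  have hℓ' : (R' : ℤ) + ℓ₀ ≤ t := by exact_mod_cast hℓ
  set m : ℕ := i - 10 with hm
  have hm1 : m + 1 ≤ 11 := by omega
  obtain ⟨eα, eβ, eW⟩ := core_AT (t := t) (R' := R') (i := i) (m := m) (by omega) (by omega)
  obtain ⟨eα', eβ', eW'⟩ := core_AT (t := t) (R' := R') (i := i + 1) (m := m + 1) (by omega) hm1
  have hms : ((m : ℤ) + 1) * t ≤ 11 * t := mul_le_mul_of_nonneg_right (by exact_mod_cast hm1) (by positivity)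
  have hmR : (m : ℤ) * R' ≤ 11 * R' := mul_le_mul_of_nonneg_right (by exact_mod_cast (show m ≤ 11 by omega)) (by positivity)
  have hm0 : (0 : ℤ) ≤ (m : ℤ) * t := by positivity
  have hmR0 : (0 : ℤ) ≤ (m : ℤ) * R' := by positivity
  have ht0 : (0 : ℤ) ≤ t := by positivity
  rw [eα, eβ, eW] at hv
  obtain ⟨ℓ, hℓ0, -, hsq, τ, hface⟩ := route_shrinkTrans hσ c (u := 2 * (t : ℤ) + (m : ℤ) * R')
    (w := 12 * (t : ℤ) + 10 * R' - (m : ℤ) * t) (w' := 12 * (t : ℤ) + 10 * R' - ((m : ℤ) + 1) * t)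
    (Δ := t) (ρ := 20 * t) (R' := R') (ℓ₀ := ℓ₀)
    (by ring) (by linarith) ht0 (by linarith) (by linarith) (by linarith) hv
  refine ⟨ℓ, hℓ0, by rw [region_A (by omega)]; exact hsq, oth a, τ, ?_⟩
  rw [core, eα', eβ', eW']
  convert hface using 2 <;> push_cast <;> ring

/-- Route of the start step `i = 21`. [cite: KozmaNitzan2024, §4 Lemmas 11–12] -/
theorem core_route_start {v : Site 2}
    (hv : v ∈ sBox a σ c (coreα t R' 21 - R') (coreβ t R' 21 + R') (coreW t R' 21 + R')) :
    ∃ ℓ : ℕ, ℓ₀ ≤ ℓ ∧ shiftF v (box 2 ℓ) ⊆ region t R' a σ c 21 ∧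
      ∃ (a' : Fin 2) (τ : Fin 2 → ℤˣ), shiftF v (orthantFace a' τ ℓ) ⊆ core t R' a σ c 22 := by
  have hR' : 100 * (R' : ℤ) ≤ t := by exact_mod_cast hR
  have hℓ' : (R' : ℤ) + ℓ₀ ≤ t := by exact_mod_cast hℓ
  obtain ⟨eα, eβ, eW⟩ := core_AT (t := t) (R' := R') (i := 21) (m := 11) rfl le_rfl
  obtain ⟨eα', eβ', eW'⟩ := core_B (t := t) (R' := R') (i := 22) (j := 1) rfl le_rfl
  rw [eα, eβ, eW] at hv
  have hR0 : (0 : ℤ) ≤ R' := by positivity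
  obtain ⟨ℓ, hℓ0, -, -, hsq, τ, -, hface⟩ := route_start hσ c (q := 2 * (t : ℤ) + 11 * R')
    (q' := 12 * (t : ℤ) + 10 * R' - 11 * t) (s := t) (w₁ := w₁ t R') (ρ := 20 * t) (R' := R') (ℓ₀ := ℓ₀)
    hℓ' (by unfold w₁; linarith) (by linarith) (by linarith) (by convert hv using 2 <;> push_cast <;> ring)
  refine ⟨ℓ, hℓ0, ?_, a, τ, ?_⟩
  · rw [region_A le_rfl]
    exact hsq.trans (sBox_mono hσ c le_rfl (by linarith) le_rfl)
  · rw [core, eα', eβ', eW']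
    convert hface using 2 <;> push_cast <;> ring

/-- Routes of the advance steps `i = 21 + j`, `1 ≤ j ≤ 65`. [cite: KozmaNitzan2024, §4 Lemma 11 (pp. 22–23)] -/
theorem core_route_B {i j : ℕ} (hij : i = 21 + j) (hj : 1 ≤ j) (hjB : j ≤ 65) {v : Site 2}
    (hv : v ∈ sBox a σ c (coreα t R' i - R') (coreβ t R' i + R') (coreW t R' i + R')) :
    ∃ ℓ : ℕ, ℓ₀ ≤ ℓ ∧ shiftF v (box 2 ℓ) ⊆ region t R' a σ c i ∧
      ∃ (a' : Fin 2) (τ : Fin 2 → ℤˣ), shiftF v (orthantFace a' τ ℓ) ⊆ core t R' a σ c (i + 1) := by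
  have hR' : 100 * (R' : ℤ) ≤ t := by exact_mod_cast hR
  have hℓ' : (R' : ℤ) + ℓ₀ ≤ t := by exact_mod_cast hℓ
  obtain ⟨eα, eβ, eW⟩ := core_B (t := t) (R' := R') hij hj
  obtain ⟨eα', eβ', eW'⟩ := core_B (t := t) (R' := R') (i := i + 1) (j := j + 1) (by omega) (by omega)
  have hjR : ((j : ℤ) - 1) * R' ≤ 64 * R' := mul_le_mul_of_nonneg_right (by linarith [(by exact_mod_cast hjB : (j : ℤ) ≤ 65)]) (by positivity)
  have hjR0 : 0 ≤ ((j : ℤ) - 1) * R' := mul_nonneg (by linarith [(by exact_mod_cast hj : (1 : ℤ) ≤ j)]) (by positivity)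
  have hR0 : (0 : ℤ) ≤ R' := by positivity
  rw [eα, eβ, eW] at hv
  obtain ⟨ℓ, hℓ0, -, -, hsq, τ, -, hface⟩ := route_advance hσ c (L := 2 * (t : ℤ) + 11 * R' + (j : ℤ) * t) (s := t)
    (w := w₁ t R' + ((j : ℤ) - 1) * R') (ρ := 8 * t) (R' := R') (ℓ₀ := ℓ₀) hℓ' (by linarith) (by unfold w₁; linarith)
    (by unfold w₁; linarith) hv
  refine ⟨ℓ, hℓ0, by rw [region_B hij hj]; exact hsq, a, τ, ?_⟩
  rw [core, eα', eβ', eW']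
  convert hface using 2 <;> push_cast <;> ring

/-- **ROUTES.**  For every step `i ≤ 86` and every `v` in the `R'`-enlargement of `core i` there is a scale `ℓ ≥ ℓ₀` with the square
`v + Λ_ℓ ⊆ region i` and a quarter-face `v + orthantFace a' τ ℓ ⊆ core (i+1)`. [cite: KozmaNitzan2024, §4 Lemmas 11–12] -/
theorem core_route {i : ℕ} (hi : i ≤ nLast) {v : Site 2}
    (hv : v ∈ sBox a σ c (coreα t R' i - R') (coreβ t R' i + R') (coreW t R' i + R')) :
    ∃ ℓ : ℕ, ℓ₀ ≤ ℓ ∧ shiftF v (box 2 ℓ) ⊆ region t R' a σ c i ∧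
      ∃ (a' : Fin 2) (τ : Fin 2 → ℤˣ), shiftF v (orthantFace a' τ ℓ) ⊆ core t R' a σ c (i + 1) := by
  unfold nLast at hi
  by_cases h1 : i < 10
  · exact core_route_AL hσ c hR hℓ h1 hv
  by_cases h2 : i < 21
  · exact core_route_AT hσ c hR hℓ (by omega) h2 hv
  by_cases h3 : i = 21
  · subst h3; exact core_route_start hσ c hR hℓ hv
  · exact core_route_B hσ c hR hℓ (j := i - 21) (by omega) (by omega) (by omega) hv

end Route

/-! ## Containments -/

section Boxes

variable {a : Fin 2} {σ : ℤ} (hσ : σ = 1 ∨ σ = -1) (c : Site 2) (hR : 100 * R' ≤ t)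
include hσ hR

/-- **The `R'`-enlargement of the core lies in the region.** [cite: KozmaNitzan2024, §4 Lemmas 11–12] -/
theorem enlarge_core_subset_region {i : ℕ} (hi : i ≤ nLast) :
    sBox a σ c (coreα t R' i - R') (coreβ t R' i + R') (coreW t R' i + R') ⊆ region t R' a σ c i := by
  unfold nLast at hi
  have hR' : 100 * (R' : ℤ) ≤ t := by exact_mod_cast hR
  have hR0 : (0 : ℤ) ≤ R' := by positivity
  by_cases h1 : i ≤ 10
  · obtain ⟨eα, eβ, eW⟩ := core_AL (t := t) (R' := R') h1
    have his : (i : ℤ) * t ≤ 10 * t := mul_le_mul_of_nonneg_right (by exact_mod_cast h1) (by positivity)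
    have hiR : (i : ℤ) * R' ≤ 10 * R' := mul_le_mul_of_nonneg_right (by exact_mod_cast h1) hR0
    have hi0 : (0 : ℤ) ≤ (i : ℤ) * t := by positivity
    have hiR0 : (0 : ℤ) ≤ (i : ℤ) * R' := by positivity
    rw [eα, eβ, eW, region_A (by omega)]
    exact sBox_mono hσ c (by linarith) (by linarith) (by linarith)
  by_cases h2 : i ≤ 21
  · obtain ⟨eα, eβ, eW⟩ := core_AT (t := t) (R' := R') (i := i) (m := i - 10) (by omega) (by omega)
    have hms : ((i - 10 : ℕ) : ℤ) * t ≤ 11 * t := mul_le_mul_of_nonneg_right (by exact_mod_cast (show i - 10 ≤ 11 by omega)) (by positivity)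
    have hmR : ((i - 10 : ℕ) : ℤ) * R' ≤ 11 * R' := mul_le_mul_of_nonneg_right (by exact_mod_cast (show i - 10 ≤ 11 by omega)) hR0
    have hm0 : (0 : ℤ) ≤ ((i - 10 : ℕ) : ℤ) * t := by positivity
    have hmR0 : (0 : ℤ) ≤ ((i - 10 : ℕ) : ℤ) * R' := by positivity
    rw [eα, eβ, eW, region_A h2]
    exact sBox_mono hσ c (by linarith) (by linarith) (by linarith)
  · obtain ⟨eα, eβ, eW⟩ := core_B (t := t) (R' := R') (i := i) (j := i - 21) (by omega) (by omega)
    have h65 : ((i - 21 : ℕ) : ℤ) ≤ 65 := by exact_mod_cast (show i - 21 ≤ 65 by omega)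
    have hjR : (((i - 21 : ℕ) : ℤ) - 1) * R' ≤ 64 * R' := mul_le_mul_of_nonneg_right (by linarith) hR0
    rw [eα, eβ, eW, region_B (t := t) (R' := R') (i := i) (j := i - 21) (by omega) (by omega)]
    exact sBox_mono hσ c (by linarith) (by linarith) (by unfold w₁; linarith)

/-- **The target (the next core) lies in the region.** [cite: KozmaNitzan2024, §4 Lemmas 11–12] -/
theorem core_succ_subset_region {i : ℕ} (hi : i ≤ nLast) : core t R' a σ c (i + 1) ⊆ region t R' a σ c i := by
  unfold nLast at hi
  have hR' : 100 * (R' : ℤ) ≤ t := by exact_mod_cast hR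
  have hR0 : (0 : ℤ) ≤ R' := by positivity
  have ht0 : (0 : ℤ) ≤ t := by positivity
  rw [core]
  by_cases h1 : i + 1 ≤ 10
  · obtain ⟨eα, eβ, eW⟩ := core_AL (t := t) (R' := R') h1
    have his : ((i : ℤ) + 1) * t ≤ 10 * t := mul_le_mul_of_nonneg_right (by exact_mod_cast h1) ht0
    have hiR : ((i : ℤ) + 1) * R' ≤ 10 * R' := mul_le_mul_of_nonneg_right (by exact_mod_cast h1) hR0
    have hi0 : (0 : ℤ) ≤ ((i : ℤ) + 1) * t := by positivity
    have hiR0 : (0 : ℤ) ≤ ((i : ℤ) + 1) * R' := by positivity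
    rw [eα, eβ, eW, region_A (by omega)]
    push_cast
    exact sBox_mono hσ c (by linarith) (by linarith) (by linarith)
  by_cases h2 : i + 1 ≤ 21
  · obtain ⟨eα, eβ, eW⟩ := core_AT (t := t) (R' := R') (i := i + 1) (m := i + 1 - 10) (by omega) (by omega)
    have hms : ((i + 1 - 10 : ℕ) : ℤ) * t ≤ 11 * t := mul_le_mul_of_nonneg_right (by exact_mod_cast (show i + 1 - 10 ≤ 11 by omega)) ht0
    have hmR : ((i + 1 - 10 : ℕ) : ℤ) * R' ≤ 11 * R' := mul_le_mul_of_nonneg_right (by exact_mod_cast (show i + 1 - 10 ≤ 11 by omega)) hR0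
    have hm0 : (0 : ℤ) ≤ ((i + 1 - 10 : ℕ) : ℤ) * t := by positivity
    have hmR0 : (0 : ℤ) ≤ ((i + 1 - 10 : ℕ) : ℤ) * R' := by positivity
    rw [eα, eβ, eW, region_A (by omega)]
    exact sBox_mono hσ c (by linarith) (by linarith) (by linarith)
  · set j : ℕ := i + 1 - 21 with hj
    have hj1 : 1 ≤ j := by omega
    have hjB : j ≤ 66 := by omega
    obtain ⟨eα, eβ, eW⟩ := core_B (t := t) (R' := R') (i := i + 1) (j := j) (by omega) hj1
    have hjt : (j : ℤ) * t ≤ 66 * t := mul_le_mul_of_nonneg_right (by exact_mod_cast hjB) ht0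
    have hjR : ((j : ℤ) - 1) * R' ≤ 65 * R' := mul_le_mul_of_nonneg_right (by linarith [(by exact_mod_cast hjB : (j : ℤ) ≤ 66)]) hR0
    have hjR0 : 0 ≤ ((j : ℤ) - 1) * R' := mul_nonneg (by linarith [(by exact_mod_cast hj1 : (1 : ℤ) ≤ j)]) hR0
    have hj0 : (0 : ℤ) ≤ (j : ℤ) * t := by positivity
    rw [eα, eβ, eW]
    by_cases h3 : i = 21
    · have hj' : (j : ℤ) = 1 := by exact_mod_cast (show j = 1 by omega)
      rw [region_A h3.le, hj']
      exact sBox_mono hσ c (by linarith) (by linarith) (by unfold w₁; linarith)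
    · have hij' : i = 21 + (j - 1) := by omega
      rw [region_B hij' (by omega)]
      push_cast [show 1 ≤ j by omega]
      exact sBox_mono hσ c (by linarith) (by linarith) (by unfold w₁; linarith)

/-- **The regions lie in the `Q`-box or the `H`-slab**: `{|level|,|trans| ≤ 20t} ∪ {20t ≤ level ≤ 88t, |trans| ≤ 8t}`.
[cite: KozmaNitzan2024, §4 p. 26 (Q_v, H_{v,x})] -/
theorem region_subset_boxes {i : ℕ} (hi : i ≤ nLast) :
    region t R' a σ c i ⊆ sBox a σ c (-(20 * (t : ℤ))) (20 * t) (20 * t) ∪ sBox a σ c (20 * t) (88 * t) (8 * t) := by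
  unfold nLast at hi
  by_cases h2 : i ≤ 21
  · rw [region_A h2]; exact Finset.subset_union_left
  · set j : ℕ := i - 21 with hj
    have hij : i = 21 + j := by omega
    have hj1 : 1 ≤ j := by omega
    have hjB : j ≤ 65 := by omega
    have hR' : 100 * (R' : ℤ) ≤ t := by exact_mod_cast hR
    have hR0 : (0 : ℤ) ≤ R' := by positivity
    have hjs : (j : ℤ) * t ≤ 65 * t := mul_le_mul_of_nonneg_right (by exact_mod_cast hjB) (by positivity)
    have hj0 : (0 : ℤ) ≤ (j : ℤ) * t := by positivity
    rw [region_B hij hj1]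
    intro x hx
    rw [mem_sBox_iff hσ] at hx
    obtain ⟨⟨hx1, hx2⟩, hxj⟩ := hx
    rw [Finset.mem_union, mem_sBox_iff hσ, mem_sBox_iff hσ]
    by_cases hlev : σ * (x a - c a) ≤ 20 * t
    · left
      refine ⟨⟨by linarith, hlev⟩, fun k hk => ?_⟩
      have := hxj k hk
      have ht0 : (0 : ℤ) ≤ t := by positivity
      constructor <;> linarith [this.1, this.2]
    · right
      push Not at hlev
      exact ⟨⟨hlev.le, by linarith⟩, hxj⟩

/-- **All cores are nonempty.** [folklore] -/
theorem core_nonempty {i : ℕ} (hi : i ≤ nLast + 1) : (core t R' a σ c i).Nonempty := by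
  unfold nLast at hi
  have hR' : 100 * (R' : ℤ) ≤ t := by exact_mod_cast hR
  have hR0 : (0 : ℤ) ≤ R' := by positivity
  have ht0 : (0 : ℤ) ≤ t := by positivity
  rw [core]
  by_cases h1 : i ≤ 10
  · obtain ⟨eα, eβ, eW⟩ := core_AL (t := t) (R' := R') h1
    have his : (i : ℤ) * t ≤ 10 * t := mul_le_mul_of_nonneg_right (by exact_mod_cast h1) ht0
    have hiR0 : (0 : ℤ) ≤ (i : ℤ) * R' := by positivity
    rw [eα, eβ, eW]; exact sBox_nonempty hσ c (by linarith) (by linarith)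
  by_cases h2 : i ≤ 21
  · obtain ⟨eα, eβ, eW⟩ := core_AT (t := t) (R' := R') (i := i) (m := i - 10) (by omega) (by omega)
    have hms : ((i - 10 : ℕ) : ℤ) * t ≤ 11 * t := mul_le_mul_of_nonneg_right (by exact_mod_cast (show i - 10 ≤ 11 by omega)) ht0
    have hmR0 : (0 : ℤ) ≤ ((i - 10 : ℕ) : ℤ) * R' := by positivity
    rw [eα, eβ, eW]; exact sBox_nonempty hσ c (by linarith) (by linarith)
  · obtain ⟨eα, eβ, eW⟩ := core_B (t := t) (R' := R') (i := i) (j := i - 21) (by omega) (by omega)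
    have hjR0 : 0 ≤ (((i - 21 : ℕ) : ℤ) - 1) * R' :=
      mul_nonneg (by have : (1 : ℤ) ≤ ((i - 21 : ℕ) : ℤ) := by exact_mod_cast (show 1 ≤ i - 21 by omega)
                     linarith) hR0
    rw [eα, eβ, eW]; exact sBox_nonempty hσ c le_rfl (by unfold w₁; linarith)

/-- **The first core is the `12t`-box** (`= M_x`, `3r = 12t`). [cite: KozmaNitzan2024, §4 p. 26 (M_v)] -/
theorem core_zero : core t R' a σ c 0 = sBox a σ c (-(12 * (t : ℤ))) (12 * t) (12 * t) := by
  have _ := hσ; have _ := hR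
  obtain ⟨eα, eβ, eW⟩ := core_AL (t := t) (R' := R') (i := 0) (Nat.zero_le _)
  rw [core, eα, eβ, eW]; push_cast; simp only [zero_mul, sub_zero, add_zero]

/-- **The last core lies in `{68t ≤ level ≤ 88t, |trans| ≤ 8t}`** (`⊆ M_y ∩ H_{x,y}`: `17r = 68t`, `22r = 88t`, `2r = 8t`).
[cite: KozmaNitzan2024, §4 p. 26] -/
theorem core_last_subset : core t R' a σ c (nLast + 1) ⊆ sBox a σ c (68 * t) (88 * t) (8 * t) := by
  have hR' : 100 * (R' : ℤ) ≤ t := by exact_mod_cast hR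
  have hR0 : (0 : ℤ) ≤ R' := by positivity
  obtain ⟨eα, eβ, eW⟩ := core_B (t := t) (R' := R') (i := nLast + 1) (j := 66) rfl (by norm_num)
  rw [core, eα, eβ, eW]
  push_cast
  exact sBox_mono hσ c (by linarith) (by linarith) (by unfold w₁; linarith)

end Boxes

end Sched

end ChainPlanar

end Transplant

end Summit.CriticalPhenomena.PercolationContinuityZ3.Theorems

end
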